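import Literature.RingTheory.KTheory.MilnorKWittRingReal
import Literature.RingTheory.KTheory.MilnorKModTwoRat
import HarnessLib

/-!
# LEMMA 4.5 for `F = ℚ`: every `sₙ : kₙℚ → Iⁿℚ/Iⁿ⁺¹ℚ` is bijective, and `Iⁿℚ/Iⁿ⁺¹ℚ = {0, 2ⁿ}` for `n ≥ 3`
# (Milnor, *Algebraic K-theory and quadratic forms*, Invent. Math. 9 (1970), §4)

Family `hodge`, lane `lit-hodgefound` (foundations library; seat `lit-hodgefound-p27`, generation 52, row g52-#6);
topic `RingTheory/KTheory`.  Sequel of `MilnorKStiefelWhitneyAugmentationPowers` (g41-#4: REMARK 4.2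
`sHom_injective_of_mulPow_injective`, `existsUnique_sHom_eq_of_mulPow_injective`, `mulPow_injective_of_eq`,
`sHom_zero_injective`), `MilnorKWittRingReal` (g41-#5: the same computation for `ℝ`, `signatureOrd`),
`MilnorKWittRingSignature` (g40-#18: `two_pow_dvd_signature`), `MilnorKModTwoReal` (g40-#11: `kSymbol_neg_one_ne_zero` over
an ordered field) and `MilnorKModTwoRat` (g52-#4: Milnor's Appendix THEOREM A.2 for `ℚ`, `kₙℚ = {0, l(−1)ⁿ}` for `n ≥ 3`,
`eq_zero_or_eq_kSymbol_neg_one_rat`).  PROVED THEOREMS only; no definition, no named fact, no instance, no notation,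
0 `sorry`, net debt 0 (D-0026).

## The source, verbatim

J. Milnor, *Algebraic K-theory and quadratic forms*, Invent. Math. 9 (1970) 318–344 (held `paper:doi-10-1007-bf01425486`;
bib key `Milnor1970`), §4 (p0015 L28–L35): «Evidently there are two key questions in relating k_* to the Witt ring W.
Let F be any field of characteristic ≠ 2.  QUESTION 4.3. Is the homomorphism s_n : k_nF → Iⁿ/Iⁿ⁺¹ bijective for all
values of n?  QUESTION 4.4. Is the intersection of the ideals Iⁿ equal to zero?»  (p0015 L40–L50): «LEMMA 4.5. If F is
a global field, or a direct limit of global fields, then both questions have affirmative answers.  *Proof.* Using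
Tate's explicit computation of k_*F for a global field (§… or the Appendix), we see that multiplication by l(−1) induces
isomorphisms k₃F → k₄F → k₅F → ⋯.  Together with §4.2 this proves that s_n is bijective in the case of a global
field.»  (p0015 L25–L27): «REMARK 4.2. For n > 2, this argument proves the following: If multiplication by l(−1)^{t−n}
carries k_nF injectively into k_tF, then the homomorphism s_n : k_nF → Iⁿ/Iⁿ⁺¹ is necessarily bijective.»  (p0016
L5–L8, L19): «each embedding of F in the real field gives rise to a ring homomorphism WF → Wℝ ≅ Z called the signature
[…] each such signature carries the ideal IF to 2Z».

## What is formalised (the case `F = ℚ` of LEMMA 4.5, Question 4.3)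

* §1 (any field `F`): `kOfDegC_kSymbol_neg_one_eq_pow` — `{−1, …, −1} ↦ l(−1)^m` in the commutative model `KC F` of
  `k_*F`; **`sHom_kSymbol_neg_one`** — `sₙ(l(−1)ⁿ) = 2ⁿ mod Iⁿ⁺¹` (`((−1) − (1))ⁿ = (−2)ⁿ ≡ 2ⁿ`).
* §2 (any ordered field `F`): **`klc_neg_one_pow_ne_zero_of_ordered`** — `l(−1)^m ≠ 0` in `k_*F` (g40's sign
  character); **`two_pow_not_mem_pow_succ`** — `2ⁿ ∉ Iⁿ⁺¹F` («each such signature carries the ideal IF to 2Z»: the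
  signature of `2ⁿ` is `2ⁿ`, not divisible by `2ⁿ⁺¹`), so `sₙ(l(−1)ⁿ) ≠ 0` (`sHom_kSymbol_neg_one_ne_zero`).
* §3 (`F = ℚ`): **`mulPow_rat_injective`** — the hypothesis of REMARK 4.2 «multiplication by l(−1)^{t−n} carries k_nℚ
  injectively into k_tℚ» for every `n` (for `n ≥ 3` because `kₙℚ = {0, l(−1)ⁿ}` (THEOREM A.2, g52-#4) and
  `l(−1)^t ≠ 0`; for `n = 1, 2` because `t = n`); **LEMMA 4.5 `sHom_rat_injective`, `existsUnique_sHom_rat_eq`** —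
  every `sₙ : kₙℚ → Iⁿℚ/Iⁿ⁺¹ℚ` is injective and every class of `Iⁿℚ/Iⁿ⁺¹ℚ` has exactly one preimage («s_n is
  bijective in the case of a global field», here `ℚ`); and the resulting description of the graded ring of `W(ℚ)` in
  degrees `n ≥ 3`: **`mem_pow_succ_or_sub_two_pow_mem_rat`** — every `y ∈ Iⁿℚ` is `≡ 0` or `≡ 2ⁿ (mod Iⁿ⁺¹ℚ)`,
  **`mem_pow_succ_iff_dvd_signature_rat`** — for `y ∈ Iⁿℚ`, `y ∈ Iⁿ⁺¹ℚ ↔ 2ⁿ⁺¹ ∣ sgn(y)` (the signature detects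
  `Iⁿℚ/Iⁿ⁺¹ℚ ≅ kₙℚ ≅ ℤ/2` for `n ≥ 3`).
* Not here: Question 4.4 for `ℚ` (`⋂ Iⁿℚ = 0`, the second half of LEMMA 4.5: «an element of I³F is zero if and only if
  its signature at every embedding F → R is zero […] follows immediately from the Hasse-Minkowski theorem» — it needs
  the Hasse–Minkowski theorem on Witt classes of the presented ring `WittRing ℚ`), other global fields, direct limits.

## References

* [Milnor1970] J. Milnor, *Algebraic K-theory and quadratic forms*, Invent. Math. 9 (1970) 318–344 — §4 Questions 4.3/4.4,
  Lemma 4.5 and its proof (p0015 L28–L50, p0016 L1–L20); Remark 4.2 (p0015 L25–L27); Appendix Theorem A.2 (p0024).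

Provenance: lane `lit-hodgefound`, seat `lit-hodgefound-p27` gen 52 (agent `literature-prover-lit-hodgefound-p27-g52-0`),
row g52-#6.
-/

set_option autoImplicit false

noncomputable section

namespace Literature.RingTheory.KTheory

open Function

namespace WittRing

open MilnorKStar

/-! ### §1 `sₙ(l(−1)ⁿ) = 2ⁿ mod Iⁿ⁺¹` (any field) -/

section AnyField

variable (F : Type*) [Field F]

/-- `l(−1)⋯l(−1)` (`m` factors) read in `KC F`: `kOfDegC {−1, …, −1} = l(−1)^m` (any field). [cite: Milnor1970, §4 proof of Lemma 4.5 «multiplication by l(−1)» (p0015 L42–L45); Remark 4.2 (p0015 L25–L27)] -/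
theorem kOfDegC_kSymbol_neg_one_eq_pow (m : ℕ) :
    kOfDegC F m (MilnorK.kSymbol fun _ : Fin m => (-1 : Fˣ)) = klc F (-1) ^ m := by
  rw [kOfDegC_kSymbol, List.ofFn_const, List.prod_replicate]

/-- `2ⁿ ∈ IⁿF`. [cite: Milnor1970, §4 «carries the ideal IF to 2Z» (p0016 L19); Theorem 4.1, the ideals IⁿF (p0014 L27–L31)] -/
theorem two_pow_mem_pow (n : ℕ) : (2 : WittRing F) ^ n ∈ fundIdeal F ^ n :=
  Ideal.pow_mem_pow (two_mem_fundIdeal F) n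

/-- **`sₙ(l(−1)ⁿ) = 2ⁿ mod Iⁿ⁺¹F`**: `sₙ` carries `l(−1)⋯l(−1)` to `((−1) − (1))ⁿ = (−2)ⁿ ≡ 2ⁿ`. [cite: Milnor1970, §4 Theorem 4.1 «s_n carries l(a₁)⋯l(a_n) to the product ((a₁) − (1))⋯((a_n) − (1)) modulo Iⁿ⁺¹F» (p0014 L27–L35); (−1) = −1 in W(F)] -/
theorem sHom_kSymbol_neg_one (n : ℕ) :
    sHom F n (MilnorK.kSymbol fun _ : Fin n => (-1 : Fˣ)) = grMk F n ((2 : WittRing F) ^ n) (two_pow_mem_pow F n) := by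
  rw [sHom_kSymbol]
  have hprod : (List.ofFn fun _ : Fin n => gen F (-1) - 1).prod = (-1) ^ n * 2 ^ n := by
    rw [List.ofFn_const, List.prod_replicate, gen_neg_one, ← mul_pow]; norm_num
  rw [grMk_eq_grMk_iff, hprod]
  rcases neg_one_pow_eq_or (WittRing F) n with h | h
  · rw [h, one_mul, sub_self]; exact zero_mem _
  · rw [h, neg_one_mul, neg_sub_left, ← two_mul, ← pow_succ']
    exact neg_mem (Ideal.pow_mem_pow (two_mem_fundIdeal F) (n + 1))

end AnyField

/-! ### §2 Ordered fields: `l(−1)^m ≠ 0` and `2ⁿ ∉ Iⁿ⁺¹` -/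

section Ordered

variable (F : Type*) [Field F] [LinearOrder F] [IsStrictOrderedRing F]

/-- Over an ordered field **`l(−1)^m ≠ 0` in `k_*F`** (g40's sign character `k_mF → ℤ/2` is `1` on `l(−1)^m`). [cite: Milnor1970, §1 Example 1.6 «l(−1)ⁿ is not divisible» (p0004 L16–L17); §4 proof of Lemma 4.5 (p0015 L42–L45)] -/
theorem klc_neg_one_pow_ne_zero_of_ordered (m : ℕ) : klc F (-1) ^ m ≠ 0 := by
  rw [← kOfDegC_kSymbol_neg_one_eq_pow, Ne, ← (kOfDegC F m).map_zero, (kOfDegC_injective F m).eq_iff]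
  exact MilnorK.kSymbol_neg_one_ne_zero

/-- Over an ordered field **`2ⁿ ∉ Iⁿ⁺¹F`**: the signature of `2ⁿ` is `2ⁿ`, while the signature carries `Iⁿ⁺¹` into
`2ⁿ⁺¹ℤ`. [cite: Milnor1970, §4 «each such signature carries the ideal IF to 2Z» (p0016 L19); the signature WF → Wℝ ≅ Z (p0016 L5–L8)] -/
theorem two_pow_not_mem_pow_succ (n : ℕ) : (2 : WittRing F) ^ n ∉ fundIdeal F ^ (n + 1) := fun h => by
  have h1 := two_pow_dvd_signature (nonnegPreordering F) nonnegPreordering_total h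
  rw [← signatureOrd_def, map_pow, map_ofNat] at h1
  have h2 : (2 : ℤ) ^ (n + 1) ≤ 2 ^ n := Int.le_of_dvd (pow_pos two_pos n) h1
  exact absurd h2 (not_le.2 (pow_lt_pow_right₀ one_lt_two (Nat.lt_succ_self n)))

/-- Over an ordered field `Iⁿ/Iⁿ⁺¹ ≠ 0`: `2ⁿ ∈ Iⁿ ∖ Iⁿ⁺¹`. [cite: Milnor1970, §4 (p0016 L5–L8, L19)] -/
theorem two_pow_mem_and_not_mem_of_ordered (n : ℕ) :
    (2 : WittRing F) ^ n ∈ fundIdeal F ^ n ∧ (2 : WittRing F) ^ n ∉ fundIdeal F ^ (n + 1) :=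
  ⟨two_pow_mem_pow F n, two_pow_not_mem_pow_succ F n⟩

/-- Over an ordered field **`sₙ(l(−1)ⁿ) ≠ 0`** in `Iⁿ/Iⁿ⁺¹`. [cite: Milnor1970, §4 Lemma 4.5 and its proof (p0015 L40–L50, p0016 L19)] -/
theorem sHom_kSymbol_neg_one_ne_zero (n : ℕ) : sHom F n (MilnorK.kSymbol fun _ : Fin n => (-1 : Fˣ)) ≠ 0 := by
  rw [sHom_kSymbol_neg_one, Ne, grMk_eq_zero_iff]
  exact two_pow_not_mem_pow_succ F n

end Ordered

/-! ### §3 LEMMA 4.5 for `F = ℚ` -/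

section Rat

/-- **LEMMA 4.5 for `ℚ`, the hypothesis of REMARK 4.2: multiplication by `l(−1)^{t−n}` (`t = 2ⁿ⁻¹`) is injective on
`kₙℚ` for every `n ≥ 1`** — for `n ≥ 3` because `kₙℚ = {0, l(−1)ⁿ}` (Appendix THEOREM A.2 / «Tate's explicit
computation of k_*F for a global field») and `l(−1)^t ≠ 0`; for `n = 1, 2` because `t = n`.  (Degree written `n + 1`.)
[cite: Milnor1970, §4 proof of Lemma 4.5 «multiplication by l(−1) induces isomorphisms k₃F → k₄F → k₅F → ⋯ Together with §4.2 this proves that s_n is bijective» (p0015 L42–L48); Remark 4.2 (p0015 L25–L27)] -/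
theorem mulPow_rat_injective (n : ℕ) : Function.Injective (mulPow ℚ n) := by
  rcases n with _ | _ | k
  · exact mulPow_injective_of_eq ℚ (n := 0) rfl
  · exact mulPow_injective_of_eq ℚ (n := 1) rfl
  · refine (injective_iff_map_eq_zero _).2 fun x hx => ?_
    rcases MilnorK.eq_zero_or_eq_kSymbol_neg_one_rat k x with rfl | rfl
    · rfl
    · exfalso
      have hle : k + 2 + 1 ≤ 2 ^ (k + 2) := Nat.lt_two_pow_self
      rw [mulPow_apply, kOfDegC_kSymbol_neg_one_eq_pow, ← pow_add, Nat.add_sub_cancel' hle] at hx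
      exact klc_neg_one_pow_ne_zero_of_ordered ℚ (2 ^ (k + 2)) hx

/-- **LEMMA 4.5 for `ℚ`: every `sₙ : kₙℚ → Iⁿℚ/Iⁿ⁺¹ℚ` is injective** (`n ≥ 1` by REMARK 4.2 and `mulPow_rat_injective`,
`n = 0` by `s₀ : k₀ ≅ W/I`). [cite: Milnor1970, §4 Lemma 4.5 «If F is a global field […] then both questions have affirmative answers» (p0015 L40–L41) and its proof (p0015 L42–L48)] -/
theorem sHom_rat_injective (n : ℕ) : Function.Injective (sHom ℚ n) := by
  cases n with
  | zero => exact sHom_zero_injective ℚ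
  | succ n => exact sHom_injective_of_mulPow_injective ℚ two_ne_zero (mulPow_rat_injective n)

/-- **LEMMA 4.5 for `ℚ` (Question 4.3): the `sₙ : kₙℚ ≅ Iⁿℚ/Iⁿ⁺¹ℚ` are bijective** — every class of `Iⁿℚ/Iⁿ⁺¹ℚ` has exactly
one preimage under `sₙ` (surjectivity is g40's `exists_sHom_eq`, valid over every field). [cite: Milnor1970, §4 Question 4.3 (p0015 L30–L31); Lemma 4.5 «s_n is bijective in the case of a global field» (p0015 L40–L48)] -/
theorem existsUnique_sHom_rat_eq (n : ℕ) (y : WittRing ℚ) (hy : y ∈ fundIdeal ℚ ^ n) :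
    ∃! x : MilnorK.Mod2 ℚ n, sHom ℚ n x = grMk ℚ n y hy := by
  obtain ⟨x, hx⟩ := exists_sHom_eq ℚ y hy
  exact ⟨x, hx, fun x' hx' => sHom_rat_injective n (hx'.trans hx.symm)⟩

/-- **`Iⁿℚ/Iⁿ⁺¹ℚ = {0, 2ⁿ}` for `n ≥ 3`**: every `y ∈ Iⁿℚ` is `≡ 0` or `≡ 2ⁿ (mod Iⁿ⁺¹ℚ)` — the image under the bijection
`sₙ` of `kₙℚ = {0, l(−1)ⁿ}`.  (Degree written `k + 3`.) [cite: Milnor1970, §4 Lemma 4.5 (p0015 L40–L48); Appendix Theorem A.2 «k_nF […] of order 2^r for n ≥ 3» (p0024)] -/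
theorem mem_pow_succ_or_sub_two_pow_mem_rat (k : ℕ) {y : WittRing ℚ} (hy : y ∈ fundIdeal ℚ ^ (k + 3)) :
    y ∈ fundIdeal ℚ ^ (k + 3 + 1) ∨ y - 2 ^ (k + 3) ∈ fundIdeal ℚ ^ (k + 3 + 1) := by
  obtain ⟨x, hx⟩ := exists_sHom_eq ℚ y hy
  rcases MilnorK.eq_zero_or_eq_kSymbol_neg_one_rat k x with rfl | rfl
  · left
    rwa [map_zero, eq_comm, grMk_eq_zero_iff] at hx
  · right
    rwa [sHom_kSymbol_neg_one, eq_comm, grMk_eq_grMk_iff] at hx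

/-- **The signature detects `Iⁿℚ/Iⁿ⁺¹ℚ ≅ ℤ/2` for `n ≥ 3`**: for `y ∈ Iⁿℚ`, `y ∈ Iⁿ⁺¹ℚ ↔ 2ⁿ⁺¹ ∣ sgn(y)`.  (Degree written
`k + 3`.) [cite: Milnor1970, §4 Lemma 4.5 and its proof «each such signature carries the ideal IF to 2Z» (p0015 L40–L48, p0016 L19)] -/
theorem mem_pow_succ_iff_dvd_signature_rat (k : ℕ) {y : WittRing ℚ} (hy : y ∈ fundIdeal ℚ ^ (k + 3)) :
    y ∈ fundIdeal ℚ ^ (k + 3 + 1) ↔ (2 : ℤ) ^ (k + 3 + 1) ∣ signatureOrd ℚ y := by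
  refine ⟨fun h => signatureOrd_def ℚ ▸ two_pow_dvd_signature (nonnegPreordering ℚ) nonnegPreordering_total h, fun h => ?_⟩
  rcases mem_pow_succ_or_sub_two_pow_mem_rat k hy with h' | h'
  · exact h'
  · exfalso
    have h1 := two_pow_dvd_signature (nonnegPreordering ℚ) nonnegPreordering_total h'
    rw [← signatureOrd_def, map_sub, map_pow, map_ofNat] at h1
    have h2 : (2 : ℤ) ^ (k + 3 + 1) ∣ 2 ^ (k + 3) := by simpa using (dvd_sub_comm.1 <| (dvd_sub_right h).2 h1)
    exact absurd (Int.le_of_dvd (pow_pos two_pos _) h2) (not_le.2 (pow_lt_pow_right₀ one_lt_two (Nat.lt_succ_self _)))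

/-- For `n ≥ 3` the class of `y ∈ Iⁿℚ` modulo `Iⁿ⁺¹ℚ` and the class of `l ∈ kₙℚ` with `sₙ(l) = y` vanish together: `y ∈ Iⁿ⁺¹ℚ ↔
l = 0` (`sₙ` bijective). [cite: Milnor1970, §4 Lemma 4.5 (p0015 L40–L48)] -/
theorem sHom_rat_eq_zero_iff (n : ℕ) (x : MilnorK.Mod2 ℚ n) : sHom ℚ n x = 0 ↔ x = 0 := by
  rw [← (sHom ℚ n).map_zero]; exact (sHom_rat_injective n).eq_iff

end Rat

end WittRing

end Literature.RingTheory.KTheory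

end
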